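import Mathlib
import Summits.Schanuel.Schanuel.Theses.RigidCore
import Literature.NumberTheory.Transcendental.AxSchanuelTwoGerms
import Literature.NumberTheory.Transcendental.GammaFields
import Literature.NumberTheory.Transcendental.ZilberFieldExistenceProofs
import Literature.NumberTheory.Transcendental.RoyCriterion

/-!
# Disproof work file, companion to `Disproof.lean` §16 (crux `RigidCore.MinimalCounterexampleInAcl`, stmt-Schanuel-0969) — NO ANALYTIC ARC of `𝒵_W` through a first failure

cdisprove gen 4.  Split off `Disproof.lean` to respect the 200 kB cap on crux workfiles; the same
development is proposed as `Theorems/MinimalCounterexampleInAcl/Negative/{ArcTaylorPoint,ArcFrame,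
NoAnalyticArc}.lean`.  Everything PROVED (rc 0, no `sorry`, axioms `propext/Classical.choice/Quot.sound`).

For a FIRST FAILURE `x ∈ ℂⁿ` (`x` ℚ-linearly independent, `trdeg ℚ(x, eˣ) < n`, `SchanuelRank m` for
`m < n`), `W` the ℚ-locus of `(x, eˣ)`, `𝒵_W = {z | (z, eᶻ) ∈ W}`:

* `firstFailure_no_analytic_arc` — germs `Γᵢ` analytic at `0` with `Γ(0) = x` along which every
  ℚ-relation of `(x, eˣ)` vanishes near `0` are CONSTANT near `0`: `𝒵_W` contains no analytic curve
  through `x`; `not_exists_nonconstant_arc`, `line_not_in_locus` (the straight line in a rational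
  direction is not in `𝒵_W`), `mate_no_analytic_arc_of_symm` (the same through a mate with the same
  relations — all mates of a first failure, `Disproof.lean` §11).
* Method (independent of the Khovanskii dichotomy used in `Disproof.lean` §17): Taylor map `τ` into
  `ℂ⸨X⸩` and the kernel comparison at the Taylor point (`aeval_eq_zero_iff_arc`); the relation space
  `{w ∈ ℚⁿ | Σ wᵢΓᵢ const}` and an adapted integer frame (`exists_adapted_frame`); Ax 1971 Thm 3 in
  `(ℂ⸨X⸩, d/dX)` (tree `Ax1971.add_rank_le_trdeg_of_field`) gives `r + 1 ≤ trdeg_ℂ`, while the Taylor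
  point has ℚ-rank `≤ n − 1` and the constants `κ = q·x`, `e^κ` rank `≥ m` (`SchanuelRank m`), whence a
  matroid count `trdeg_ℂ ≤ r − 1`.

## References

* [Ax1971] J. Ax, *On Schanuel's conjectures*, Ann. of Math. 93 (1971) 252–268, Thm. 3.
-/

noncomputable section

set_option linter.dupNamespace false

open Complex Set Filter Topology
open scoped Nat
open Literature.NumberTheory.Transcendental
open Literature.NumberTheory.Transcendental.AndreCriterion (coeff_taylor constantCoeff_taylor
  taylor_congr taylor_add taylor_sum taylor_const_mul taylor_mul taylor_one taylor_pow)
open Literature.Analysis.Complex.FormalRoot (taylor_eq_zero_iff taylor_sub eventuallyEq_of_taylor_eq)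
open Literature.Analysis.Complex.LaurentGerm (derivative_taylor_exp)
open Literature.RingTheory.PowerSeries (derivative_eq_zero_iff_mem_range_algebraMap)
open Literature.FieldTheory.TranscendenceDegree (trdeg_le_card_of_forall_isAlgebraic)
open Literature.NumberTheory.Transcendental.AxTwoGerms (exists_algDerivation_eq_derivative
  ofPowerSeries_taylor_exp_ne_zero algebraMap_eq_ofPowerSeries_C taylor_const)

namespace Summit.Schanuel.Schanuel.Cruxes.MinimalCounterexampleInAcl.DisproofNoArc

/-- The Taylor series of `f : ℂ → ℂ` at `0`, as a formal power series (local notation). -/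
local notation3 "𝓣[" f "]" =>
  (PowerSeries.mk fun n => ((Nat.factorial n : ℂ)⁻¹ * iteratedDeriv n f 0) : PowerSeries ℂ)

/-- Taylor series of a germ, in the Laurent series field `ℂ⸨X⸩`. -/
def τ (f : ℂ → ℂ) : LaurentSeries ℂ := HahnSeries.ofPowerSeries ℤ ℂ 𝓣[f]

/-- Unfolding `τ`. [folklore] -/
theorem τ_def (f : ℂ → ℂ) : τ f = HahnSeries.ofPowerSeries ℤ ℂ 𝓣[f] := rfl

/-- `τ` only depends on the germ at `0`. [folklore] -/
theorem τ_congr {f g : ℂ → ℂ} (h : f =ᶠ[𝓝 0] g) : τ f = τ g := by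
  rw [τ_def, τ_def, taylor_congr h]

/-- `τ` is additive on analytic germs. [folklore] -/
theorem τ_add {f g : ℂ → ℂ} (hf : AnalyticAt ℂ f 0) (hg : AnalyticAt ℂ g 0) :
    τ (fun t => f t + g t) = τ f + τ g := by
  rw [τ_def, τ_def, τ_def, ← map_add, ← taylor_add hf hg]; rfl

/-- `τ` is multiplicative on analytic germs. [folklore] -/
theorem τ_mul {f g : ℂ → ℂ} (hf : AnalyticAt ℂ f 0) (hg : AnalyticAt ℂ g 0) :
    τ (fun t => f t * g t) = τ f * τ g := by
  rw [τ_def, τ_def, τ_def, ← map_mul, ← taylor_mul hf hg]; rfl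

/-- `τ` of a constant germ is the constant Laurent series. [folklore] -/
theorem τ_const (c : ℂ) : τ (fun _ => c) = algebraMap ℂ (LaurentSeries ℂ) c := by
  rw [τ_def, taylor_const, algebraMap_eq_ofPowerSeries_C]

/-- `τ 1 = 1`. [folklore] -/
theorem τ_one : τ (fun _ => (1 : ℂ)) = 1 := by
  rw [τ_const, map_one]

/-- `τ f = 0` iff the analytic germ `f` vanishes near `0`. [folklore] -/
theorem τ_eq_zero_iff {f : ℂ → ℂ} (hf : AnalyticAt ℂ f 0) : τ f = 0 ↔ f =ᶠ[𝓝 0] 0 := by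
  rw [τ_def, map_eq_zero_iff _ HahnSeries.ofPowerSeries_injective, taylor_eq_zero_iff hf]

/-- `τ` commutes with powers. [folklore] -/
theorem τ_pow {f : ℂ → ℂ} (hf : AnalyticAt ℂ f 0) (k : ℕ) : τ (fun t => f t ^ k) = τ f ^ k := by
  induction k with
  | zero => simp only [pow_zero]; exact τ_one
  | succ k ih =>
    have hfk : AnalyticAt ℂ (fun t => f t ^ k) 0 := hf.pow k
    have e : (fun t => f t ^ (k + 1)) = fun t => f t ^ k * f t := by funext t; rw [pow_succ]
    rw [e, τ_mul hfk hf, ih, pow_succ]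

/-- Finite sums of analytic germs are analytic (pointwise form). [folklore] -/
theorem analyticAt_finset_sum {ι : Type*} (s : Finset ι) {f : ι → ℂ → ℂ}
    (hf : ∀ i ∈ s, AnalyticAt ℂ (f i) 0) : AnalyticAt ℂ (fun t => ∑ i ∈ s, f i t) 0 := by
  classical
  induction s using Finset.induction_on with
  | empty => simp only [Finset.sum_empty]; exact analyticAt_const
  | insert a s ha ih =>
    simp only [Finset.sum_insert ha]
    exact (hf a (Finset.mem_insert_self a s)).add (ih fun i hi => hf i (Finset.mem_insert_of_mem hi))

/-- Finite products of analytic germs are analytic (pointwise form). [folklore] -/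
theorem analyticAt_finset_prod {ι : Type*} (s : Finset ι) {f : ι → ℂ → ℂ}
    (hf : ∀ i ∈ s, AnalyticAt ℂ (f i) 0) : AnalyticAt ℂ (fun t => ∏ i ∈ s, f i t) 0 := by
  classical
  induction s using Finset.induction_on with
  | empty => simp only [Finset.prod_empty]; exact analyticAt_const
  | insert a s ha ih =>
    simp only [Finset.prod_insert ha]
    exact (hf a (Finset.mem_insert_self a s)).mul (ih fun i hi => hf i (Finset.mem_insert_of_mem hi))

/-- `τ` commutes with finite sums. [folklore] -/
theorem τ_sum {ι : Type*} (s : Finset ι) {f : ι → ℂ → ℂ} (hf : ∀ i ∈ s, AnalyticAt ℂ (f i) 0) :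
    τ (fun t => ∑ i ∈ s, f i t) = ∑ i ∈ s, τ (f i) := by
  classical
  induction s using Finset.induction_on with
  | empty => simp only [Finset.sum_empty]; rw [τ_const, map_zero]
  | insert a s ha ih =>
    have hfa : AnalyticAt ℂ (f a) 0 := hf a (Finset.mem_insert_self a s)
    have hfs : ∀ i ∈ s, AnalyticAt ℂ (f i) 0 := fun i hi => hf i (Finset.mem_insert_of_mem hi)
    have hsum : AnalyticAt ℂ (fun t => ∑ i ∈ s, f i t) 0 := analyticAt_finset_sum s hfs
    simp only [Finset.sum_insert ha]
    rw [τ_add hfa hsum, ih hfs]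

/-- `τ` commutes with finite products. [folklore] -/
theorem τ_prod {ι : Type*} (s : Finset ι) {f : ι → ℂ → ℂ} (hf : ∀ i ∈ s, AnalyticAt ℂ (f i) 0) :
    τ (fun t => ∏ i ∈ s, f i t) = ∏ i ∈ s, τ (f i) := by
  classical
  induction s using Finset.induction_on with
  | empty => simp only [Finset.prod_empty]; exact τ_one
  | insert a s ha ih =>
    have hfa : AnalyticAt ℂ (f a) 0 := hf a (Finset.mem_insert_self a s)
    have hfs : ∀ i ∈ s, AnalyticAt ℂ (f i) 0 := fun i hi => hf i (Finset.mem_insert_of_mem hi)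
    have hprod : AnalyticAt ℂ (fun t => ∏ i ∈ s, f i t) 0 := analyticAt_finset_prod s hfs
    simp only [Finset.prod_insert ha]
    rw [τ_mul hfa hprod, ih hfs]

/-- `τ (c·f) = c·τ f`. [folklore] -/
theorem τ_const_mul (c : ℂ) {f : ℂ → ℂ} :
    τ (fun t => c * f t) = algebraMap ℂ (LaurentSeries ℂ) c * τ f := by
  rw [τ_def, τ_def, taylor_const_mul, map_mul, ← algebraMap_eq_ofPowerSeries_C]

/-- Value at `0` of an eventually constant germ. -/
theorem eq_of_eventually_const {f : ℂ → ℂ} {c : ℂ} (h : ∀ᶠ t in 𝓝 (0:ℂ), f t = c) : f 0 = c :=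
  h.self_of_nhds

section Arc

variable {n : ℕ} (Γ : Fin n → ℂ → ℂ)

/-- The point `(Γ̂, (e^Γ)^)` of `ℂ⸨X⸩^{2n}`. -/
def arcPt : Fin n ⊕ Fin n → LaurentSeries ℂ :=
  Sum.elim (fun i => τ (Γ i)) (fun i => τ (fun t => cexp (Γ i t)))

/-- The germ `t ↦ p(Γ(t), e^{Γ(t)})`. -/
def arcFun (p : MvPolynomial (Fin n ⊕ Fin n) ℚ) : ℂ → ℂ :=
  fun t => MvPolynomial.aeval (Sum.elim (fun i => Γ i t) (fun i => cexp (Γ i t))) p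

variable {Γ}

/-- The `ℚ`-algebra map of `ℂ⸨X⸩` factors through `ℂ` (ring maps out of `ℚ` are unique). [folklore] -/
theorem algebraMap_rat_eq (a : ℚ) [CharZero (LaurentSeries ℂ)] :
    algebraMap ℚ (LaurentSeries ℂ) a = algebraMap ℂ (LaurentSeries ℂ) (a : ℂ) := by
  have h : (algebraMap ℚ (LaurentSeries ℂ)) = (algebraMap ℂ (LaurentSeries ℂ)).comp (algebraMap ℚ ℂ) :=
    Subsingleton.elim _ _
  rw [h]; rfl

/-- **Taylor expansion commutes with polynomial evaluation along the arc.** -/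
theorem arcFun_analytic_and_aeval [CharZero (LaurentSeries ℂ)] (hΓ : ∀ i, AnalyticAt ℂ (Γ i) 0)
    (p : MvPolynomial (Fin n ⊕ Fin n) ℚ) :
    AnalyticAt ℂ (arcFun Γ p) 0 ∧ MvPolynomial.aeval (arcPt Γ) p = τ (arcFun Γ p) := by
  induction p using MvPolynomial.induction_on with
  | C a =>
    have e : arcFun Γ (MvPolynomial.C a) = fun _ => (a : ℂ) := by
      funext t; simp [arcFun]
    refine ⟨by rw [e]; exact analyticAt_const, ?_⟩
    rw [e, MvPolynomial.aeval_C, τ_const, algebraMap_rat_eq]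
  | add p q hp hq =>
    have e : arcFun Γ (p + q) = fun t => arcFun Γ p t + arcFun Γ q t := by
      funext t; simp [arcFun]
    refine ⟨by rw [e]; exact hp.1.add hq.1, ?_⟩
    rw [map_add, e, τ_add hp.1 hq.1, hp.2, hq.2]
  | mul_X p i hp =>
    have hcoord : AnalyticAt ℂ (fun t => (Sum.elim (fun i => Γ i t) (fun i => cexp (Γ i t)) i : ℂ)) 0 := by
      rcases i with i | i
      · show AnalyticAt ℂ (fun t => Γ i t) 0
        exact hΓ i
      · show AnalyticAt ℂ (fun t => cexp (Γ i t)) 0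
        exact analyticAt_cexp.comp (hΓ i)
    have e : arcFun Γ (p * MvPolynomial.X i) =
        fun t => arcFun Γ p t * Sum.elim (fun i => Γ i t) (fun i => cexp (Γ i t)) i := by
      funext t; simp [arcFun]
    refine ⟨by rw [e]; exact hp.1.mul hcoord, ?_⟩
    rw [map_mul, MvPolynomial.aeval_X, e, τ_mul hp.1 hcoord, hp.2]
    congr 1
    rcases i with i | i <;> rfl

/-- The arc germ `t ↦ p(Γ(t), e^{Γ(t)})` is analytic at `0`. [folklore] -/
theorem analyticAt_arcFun [CharZero (LaurentSeries ℂ)] (hΓ : ∀ i, AnalyticAt ℂ (Γ i) 0)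
    (p : MvPolynomial (Fin n ⊕ Fin n) ℚ) : AnalyticAt ℂ (arcFun Γ p) 0 :=
  (arcFun_analytic_and_aeval hΓ p).1

/-- Evaluation at the Taylor point is the Taylor series of the arc germ. [folklore] -/
theorem aeval_arcPt [CharZero (LaurentSeries ℂ)] (hΓ : ∀ i, AnalyticAt ℂ (Γ i) 0)
    (p : MvPolynomial (Fin n ⊕ Fin n) ℚ) : MvPolynomial.aeval (arcPt Γ) p = τ (arcFun Γ p) :=
  (arcFun_analytic_and_aeval hΓ p).2

/-- Value of the arc germ at `t = 0`. -/
theorem arcFun_zero {x : Fin n → ℂ} (h0 : ∀ i, Γ i 0 = x i) (p : MvPolynomial (Fin n ⊕ Fin n) ℚ) :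
    arcFun Γ p 0 = MvPolynomial.aeval (Sum.elim x (cexp ∘ x)) p := by
  simp only [arcFun]
  congr 2
  funext j; rcases j with j | j <;> simp [h0]

/-- **Kernel comparison**: along an analytic arc of `𝒵_W` through `x`, a ℚ-polynomial vanishes at
`(x, eˣ)` iff it vanishes at the Taylor point `(Γ̂, (e^Γ)^)` of `ℂ⸨X⸩`. -/
theorem aeval_eq_zero_iff_arc [CharZero (LaurentSeries ℂ)] {x : Fin n → ℂ}
    (hΓ : ∀ i, AnalyticAt ℂ (Γ i) 0) (h0 : ∀ i, Γ i 0 = x i)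
    (hW : ∀ p : MvPolynomial (Fin n ⊕ Fin n) ℚ,
      MvPolynomial.aeval (Sum.elim x (cexp ∘ x)) p = 0 →
      ∀ᶠ t in 𝓝 (0:ℂ), MvPolynomial.aeval (Sum.elim (fun i => Γ i t) (fun i => cexp (Γ i t))) p = 0)
    (p : MvPolynomial (Fin n ⊕ Fin n) ℚ) :
    MvPolynomial.aeval (Sum.elim x (cexp ∘ x)) p = 0 ↔ MvPolynomial.aeval (arcPt Γ) p = 0 := by
  rw [aeval_arcPt hΓ, τ_eq_zero_iff (analyticAt_arcFun hΓ p)]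
  constructor
  · intro h
    exact hW p h
  · intro h
    rw [← arcFun_zero h0 p]
    exact h.self_of_nhds

end Arc


/-! ### Linear algebra: an integer frame adapted to a proper subspace of `ℚⁿ` -/

/-- Clearing denominators of a rational vector. -/
theorem exists_int_vector {n : ℕ} (v : Fin n → ℚ) :
    ∃ (N : ℕ) (w : Fin n → ℤ), N ≠ 0 ∧ ∀ i, (w i : ℚ) = (N : ℚ) * v i := by
  classical
  refine ⟨∏ j, (v j).den, fun i => (∏ j ∈ Finset.univ.erase i, ((v j).den : ℤ)) * (v i).num,
    ?_, fun i => ?_⟩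
  · exact Finset.prod_ne_zero_iff.2 fun j _ => (v j).den_nz
  · show (((∏ j ∈ Finset.univ.erase i, ((v j).den : ℤ)) * (v i).num : ℤ) : ℚ) =
      ((∏ j, (v j).den : ℕ) : ℚ) * v i
    push_cast
    rw [← Finset.prod_erase_mul Finset.univ (fun j => ((v j).den : ℚ)) (Finset.mem_univ i),
      mul_assoc, Rat.den_mul_eq_num]

/-- **Adapted integer frame.** For a proper subspace `R ⊊ ℚⁿ` there are integer vectors
`q₁,…,q_m` forming a ℚ-basis of `R` and integer vectors `c₁,…,c_r` (`r = n − m ≥ 1`) independent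
modulo `R`. [folklore] -/
theorem exists_adapted_frame {n : ℕ} (R : Submodule ℚ (Fin n → ℚ)) (hR : R ≠ ⊤) :
    ∃ (m r : ℕ) (q : Fin m → Fin n → ℤ) (c : Fin r → Fin n → ℤ), 0 < r ∧ m + r = n ∧
      LinearIndependent ℚ (fun j i => (q j i : ℚ)) ∧
      (∀ j, (fun i => (q j i : ℚ)) ∈ R) ∧
      (∀ b : Fin r → ℚ, (∑ k, b k • fun i => (c k i : ℚ)) ∈ R → b = 0) := by
  classical
  obtain ⟨R', hRR'⟩ := Submodule.exists_isCompl R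
  let bR := Module.finBasis ℚ R
  let bR' := Module.finBasis ℚ R'
  choose N w hN hw using fun j : Fin (Module.finrank ℚ R) => exists_int_vector ((bR j : R) : Fin n → ℚ)
  choose N' w' hN' hw' using
    fun k : Fin (Module.finrank ℚ R') => exists_int_vector ((bR' k : R') : Fin n → ℚ)
  refine ⟨Module.finrank ℚ R, Module.finrank ℚ R', w, w', ?_, ?_, ?_, ?_, ?_⟩
  · refine Nat.pos_of_ne_zero fun h0 => ?_
    have hbot : R' = ⊥ := Submodule.finrank_eq_zero.1 h0
    apply hR
    have := hRR'.sup_eq_top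
    rwa [hbot, sup_bot_eq] at this
  · have h := Submodule.finrank_add_eq_of_isCompl hRR'
    rwa [Module.finrank_fin_fun] at h
  · -- linear independence of the scaled basis vectors
    have hli : LinearIndependent ℚ (fun j => ((bR j : R) : Fin n → ℚ)) :=
      bR.linearIndependent.map' R.subtype (Submodule.ker_subtype R)
    have hli' := hli.units_smul fun j => Units.mk0 (N j : ℚ) (Nat.cast_ne_zero.2 (hN j))
    convert hli' using 1
    funext j i
    simp only [Pi.smul_apply', Units.smul_def, Units.val_mk0, Pi.smul_apply, smul_eq_mul]
    exact hw j i
  · intro j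
    have e : (fun i => (w j i : ℚ)) = (N j : ℚ) • ((bR j : R) : Fin n → ℚ) := by
      funext i; simp only [Pi.smul_apply, smul_eq_mul]; exact hw j i
    rw [e]
    exact R.smul_mem _ (bR j).2
  · intro b hb
    -- the combination lies in `R ⊓ R' = ⊥`
    have e : (∑ k, b k • fun i => (w' k i : ℚ)) =
        ∑ k, (b k * (N' k : ℚ)) • ((bR' k : R') : Fin n → ℚ) := by
      refine Finset.sum_congr rfl fun k _ => ?_
      funext i
      simp only [Pi.smul_apply, smul_eq_mul, hw' k i]
      ring
    have hmem' : (∑ k, b k • fun i => (w' k i : ℚ)) ∈ R' := by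
      rw [e]
      exact R'.sum_mem fun k _ => R'.smul_mem _ (bR' k).2
    have hzero : (∑ k, (b k * (N' k : ℚ)) • ((bR' k : R') : Fin n → ℚ)) = 0 := by
      rw [← e]
      have hinf : (∑ k, b k • fun i => (w' k i : ℚ)) ∈ R ⊓ R' := ⟨hb, hmem'⟩
      rwa [hRR'.inf_eq_bot, Submodule.mem_bot] at hinf
    have hli : LinearIndependent ℚ (fun k => ((bR' k : R') : Fin n → ℚ)) :=
      bR'.linearIndependent.map' R'.subtype (Submodule.ker_subtype R')
    have hcoef := (Fintype.linearIndependent_iff.1 hli) _ hzero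
    funext k
    have hk := hcoef k
    rcases mul_eq_zero.1 hk with h | h
    · exact h
    · exact absurd h (Nat.cast_ne_zero.2 (hN' k))

/-! ### The space of linear relations of the arc (germs `Σ wᵢ Γᵢ` that are constant) -/

section Rel

variable {n : ℕ}

/-- Rational vectors `w` with `Σ wᵢ Γᵢ` constant near `0`. -/
def relSubmodule (Γ : Fin n → ℂ → ℂ) : Submodule ℚ (Fin n → ℚ) where
  carrier := {w | ∃ c : ℂ, ∀ᶠ t in 𝓝 (0:ℂ), ∑ i, ((w i : ℚ) : ℂ) * Γ i t = c}
  zero_mem' := ⟨0, Eventually.of_forall fun t => by simp⟩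
  add_mem' := by
    rintro w w' ⟨c, hc⟩ ⟨c', hc'⟩
    refine ⟨c + c', ?_⟩
    filter_upwards [hc, hc'] with t ht ht'
    simp only [Pi.add_apply, Rat.cast_add, add_mul, Finset.sum_add_distrib, ht, ht']
  smul_mem' := by
    rintro a w ⟨c, hc⟩
    refine ⟨(a : ℂ) * c, ?_⟩
    filter_upwards [hc] with t ht
    simp only [Pi.smul_apply, smul_eq_mul, Rat.cast_mul, mul_assoc, ← Finset.mul_sum, ht]

variable {Γ : Fin n → ℂ → ℂ} {x : Fin n → ℂ}

/-- Membership in the relation space. [folklore] -/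
theorem mem_relSubmodule_iff (w : Fin n → ℚ) :
    w ∈ relSubmodule Γ ↔ ∃ c : ℂ, ∀ᶠ t in 𝓝 (0:ℂ), ∑ i, ((w i : ℚ) : ℂ) * Γ i t = c := Iff.rfl

/-- The constant is the value at `0`. -/
theorem eventually_eq_sum_of_mem (h0 : ∀ i, Γ i 0 = x i) {w : Fin n → ℚ}
    (hw : w ∈ relSubmodule Γ) :
    ∀ᶠ t in 𝓝 (0:ℂ), ∑ i, ((w i : ℚ) : ℂ) * Γ i t = ∑ i, ((w i : ℚ) : ℂ) * x i := by
  obtain ⟨c, hc⟩ := hw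
  have h := hc.self_of_nhds
  simp only [h0] at h
  rw [h]
  exact hc

/-- Rational combinations of the Taylor series are Taylor series of the combinations. -/
theorem sum_smul_τ (hΓ : ∀ i, AnalyticAt ℂ (Γ i) 0) (w : Fin n → ℂ) :
    (∑ i, algebraMap ℂ (LaurentSeries ℂ) (w i) * τ (Γ i)) = τ (fun t => ∑ i, w i * Γ i t) := by
  rw [τ_sum Finset.univ (f := fun i t => w i * Γ i t) (fun i _ => analyticAt_const.mul (hΓ i))]
  refine Finset.sum_congr rfl fun i _ => ?_
  rw [τ_const_mul]

/-- `d/dX (τ g) = 0` iff the germ `g` is constant. -/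
theorem derivative_τ_eq_zero_iff {g : ℂ → ℂ} (hg : AnalyticAt ℂ g 0) :
    LaurentSeries.derivative ℂ (τ g) = 0 ↔ ∃ c : ℂ, ∀ᶠ t in 𝓝 (0:ℂ), g t = c := by
  rw [τ_def, derivative_eq_zero_iff_mem_range_algebraMap]
  constructor
  · rintro ⟨c, hc⟩
    refine ⟨c, ?_⟩
    rw [algebraMap_eq_ofPowerSeries_C] at hc
    have hc' := HahnSeries.ofPowerSeries_injective hc
    rw [← taylor_const] at hc'
    exact (eventuallyEq_of_taylor_eq analyticAt_const hg hc').symm.mono fun t ht => ht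
  · rintro ⟨c, hc⟩
    refine ⟨c, ?_⟩
    have e : τ g = τ (fun _ => c) := τ_congr (hc.mono fun t ht => ht)
    rw [τ_def, τ_def] at e
    rw [e, ← τ_def, τ_const]

/-- **Relations ⟷ vanishing derivative**: for a rational vector `w`,
`d/dX (Σ wᵢ Γ̂ᵢ) = 0 ↔ w ∈ relSubmodule Γ`. -/
theorem derivative_sum_eq_zero_iff (hΓ : ∀ i, AnalyticAt ℂ (Γ i) 0) (w : Fin n → ℚ) :
    LaurentSeries.derivative ℂ (∑ i, algebraMap ℂ (LaurentSeries ℂ) ((w i : ℚ) : ℂ) * τ (Γ i)) = 0 ↔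
      w ∈ relSubmodule Γ := by
  rw [sum_smul_τ hΓ, derivative_τ_eq_zero_iff (analyticAt_finset_sum Finset.univ
    (f := fun i t => ((w i : ℚ) : ℂ) * Γ i t) fun i _ => analyticAt_const.mul (hΓ i))]
  rfl

/-- For a relation vector the combination of Taylor series IS the constant `Σ wᵢ xᵢ`. -/
theorem sum_smul_τ_eq_algebraMap (hΓ : ∀ i, AnalyticAt ℂ (Γ i) 0) (h0 : ∀ i, Γ i 0 = x i)
    {w : Fin n → ℚ} (hw : w ∈ relSubmodule Γ) :
    (∑ i, algebraMap ℂ (LaurentSeries ℂ) ((w i : ℚ) : ℂ) * τ (Γ i)) =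
      algebraMap ℂ (LaurentSeries ℂ) (∑ i, ((w i : ℚ) : ℂ) * x i) := by
  rw [sum_smul_τ hΓ, ← τ_const]
  exact τ_congr (eventually_eq_sum_of_mem h0 hw)

end Rel


/-! ### Exponentials of integer combinations; transport of independence to `ℂ⸨X⸩` -/

section Aux

variable {n : ℕ} {Γ : Fin n → ℂ → ℂ}

/-- `exp (Σ aᵢ Γᵢ) = Π exp(Γᵢ)^{aᵢ⁺} exp(−Γᵢ)^{aᵢ⁻}` for integers `aᵢ`. [folklore] -/
theorem cexp_intCombination (Γ : Fin n → ℂ → ℂ) (a : Fin n → ℤ) (t : ℂ) :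
    cexp (∑ i, (a i : ℂ) * Γ i t) =
      ∏ i, (cexp (Γ i t) ^ (a i).toNat * cexp (-(Γ i t)) ^ (-a i).toNat) := by
  rw [Complex.exp_sum]
  refine Finset.prod_congr rfl fun i _ => ?_
  have hz : (((a i).toNat : ℤ) - ((-a i).toNat : ℤ)) = a i := Int.toNat_sub_toNat_neg (a i)
  have hc : (a i : ℂ) = ((a i).toNat : ℂ) - ((-a i).toNat : ℂ) := by
    have h := congrArg (fun z : ℤ => (z : ℂ)) hz
    push_cast at h
    exact h.symm
  rw [hc, show (((a i).toNat : ℂ) - ((-a i).toNat : ℂ)) * Γ i t =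
      ((a i).toNat : ℂ) * Γ i t + ((-a i).toNat : ℂ) * (-(Γ i t)) by ring,
    Complex.exp_add, Complex.exp_nat_mul, Complex.exp_nat_mul]

/-- Taylor series form of `cexp_intCombination`. [folklore] -/
theorem τ_cexp_intCombination (hΓ : ∀ i, AnalyticAt ℂ (Γ i) 0) (a : Fin n → ℤ) :
    τ (fun t => cexp (∑ i, (a i : ℂ) * Γ i t)) =
      ∏ i, (τ (fun t => cexp (Γ i t)) ^ (a i).toNat * τ (fun t => cexp (-(Γ i t))) ^ (-a i).toNat) := by
  have e : (fun t => cexp (∑ i, (a i : ℂ) * Γ i t)) =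
      fun t => ∏ i, (cexp (Γ i t) ^ (a i).toNat * cexp (-(Γ i t)) ^ (-a i).toNat) := by
    funext t; exact cexp_intCombination Γ a t
  have hE : ∀ i, AnalyticAt ℂ (fun t => cexp (Γ i t)) 0 := fun i => analyticAt_cexp.comp (hΓ i)
  have hE' : ∀ i, AnalyticAt ℂ (fun t => cexp (-(Γ i t))) 0 := fun i =>
    analyticAt_cexp.comp (hΓ i).neg
  have hEp : ∀ i (k : ℕ), AnalyticAt ℂ (fun t => cexp (Γ i t) ^ k) 0 := fun i k => (hE i).pow k
  have hE'p : ∀ i (k : ℕ), AnalyticAt ℂ (fun t => cexp (-(Γ i t)) ^ k) 0 := fun i k => (hE' i).pow k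
  rw [e, τ_prod Finset.univ
    (f := fun i t => cexp (Γ i t) ^ (a i).toNat * cexp (-(Γ i t)) ^ (-a i).toNat)
    (fun i _ => (hEp i _).mul (hE'p i _))]
  refine Finset.prod_congr rfl fun i _ => ?_
  rw [τ_mul (f := fun t => cexp (Γ i t) ^ (a i).toNat) (g := fun t => cexp (-(Γ i t)) ^ (-a i).toNat)
    (hEp i _) (hE'p i _), τ_pow (f := fun t => cexp (Γ i t)) (hE i),
    τ_pow (f := fun t => cexp (-(Γ i t))) (hE' i)]

/-- `τ(e^{g}) · τ(e^{−g}) = 1`. [folklore] -/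
theorem τ_cexp_mul_τ_cexp_neg {g : ℂ → ℂ} (hg : AnalyticAt ℂ g 0) :
    τ (fun t => cexp (g t)) * τ (fun t => cexp (-(g t))) = 1 := by
  rw [← τ_mul (f := fun t => cexp (g t)) (g := fun t => cexp (-(g t)))
    (analyticAt_cexp.comp hg) (analyticAt_cexp.comp hg.neg)]
  have e : (fun t => cexp (g t) * cexp (-(g t))) = fun _ => (1:ℂ) := by
    funext t; rw [← Complex.exp_add, add_neg_cancel, Complex.exp_zero]
  rw [e, τ_one]

/-- Algebraically independent complex numbers stay independent as constants of `ℂ⸨X⸩`. -/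
theorem indep_image_algebraMap [CharZero (LaurentSeries ℂ)] {I : Set ℂ}
    (hI : (GammaField.algMatroid ℂ).Indep I) :
    (GammaField.algMatroid (LaurentSeries ℂ)).Indep (algebraMap ℂ (LaurentSeries ℂ) '' I) := by
  rw [AlgebraicIndependent.matroid_indep_iff] at hI ⊢
  let f : ℂ →ₐ[ℚ] LaurentSeries ℂ := (algebraMap ℂ (LaurentSeries ℂ)).toRatAlgHom
  have hf : Function.Injective f := (algebraMap ℂ (LaurentSeries ℂ)).injective
  have h1 : AlgebraicIndependent ℚ (f ∘ fun z : I => (z : ℂ)) := AlgebraicIndependent.map' hI hf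
  let e : I ≃ (f '' I) := Equiv.Set.image f I hf
  have h2 : (fun y : (f '' I) => (y : LaurentSeries ℂ)) ∘ e = f ∘ fun z : I => (z : ℂ) := by
    funext z; rfl
  exact (algebraicIndependent_equiv' e h2).1 h1

/-- The ℚ-transcendence rank does not drop when complex numbers are viewed as constants of `ℂ⸨X⸩`. [folklore] -/
theorem eRk_le_eRk_image_algebraMap [CharZero (LaurentSeries ℂ)] (S : Set ℂ) :
    (GammaField.algMatroid ℂ).eRk S ≤
      (GammaField.algMatroid (LaurentSeries ℂ)).eRk (algebraMap ℂ (LaurentSeries ℂ) '' S) := by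
  obtain ⟨I, hI⟩ := (GammaField.algMatroid ℂ).exists_isBasis S
  rw [hI.eRk_eq_encard,
    ← ((algebraMap ℂ (LaurentSeries ℂ)).injective.injOn (s := I)).encard_image]
  exact (indep_image_algebraMap hI.indep).encard_le_eRk_of_subset (Set.image_mono hI.subset)

end Aux

/-! ### The theorem -/

section Main

variable {n : ℕ}

set_option maxHeartbeats 1600000 in
/-- **No analytic arc of `𝒵_W = {z | (z, eᶻ) ∈ W}` passes through a first failure** (`W` = the
ℚ-locus of `(x, eˣ)`): Ax–Schanuel in `ℂ⸨X⸩` + `SchanuelRank m` for `m < n`. -/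
theorem no_analytic_arc_through_firstFailure [CharZero (LaurentSeries ℂ)] {x : Fin n → ℂ}
    (hli : LinearIndependent ℚ x)
    (htr : Algebra.trdeg ℚ ↥(IntermediateField.adjoin ℚ (range x ∪ range (cexp ∘ x))) < (n : Cardinal))
    (hrank : ∀ r < n, SchanuelRank r)
    (Γ : Fin n → ℂ → ℂ) (hΓ : ∀ i, AnalyticAt ℂ (Γ i) 0) (h0 : ∀ i, Γ i 0 = x i)
    (hW : ∀ p : MvPolynomial (Fin n ⊕ Fin n) ℚ,
      MvPolynomial.aeval (Sum.elim x (cexp ∘ x)) p = 0 →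
      ∀ᶠ t in 𝓝 (0:ℂ), MvPolynomial.aeval (Sum.elim (fun i => Γ i t) (fun i => cexp (Γ i t))) p = 0) :
    ∀ i, ∀ᶠ t in 𝓝 (0:ℂ), Γ i t = x i := by
  classical
  set Rl := relSubmodule Γ with hRl
  -- Step 0: it suffices that every rational vector is a relation
  suffices htop : Rl = ⊤ by
    intro i
    have hmem : (Pi.single i (1:ℚ) : Fin n → ℚ) ∈ Rl := by rw [htop]; exact Submodule.mem_top
    have h := eventually_eq_sum_of_mem h0 hmem
    have hsingle : ∀ f : Fin n → ℂ, (∑ j, ((Pi.single i (1:ℚ) : Fin n → ℚ) j : ℂ) * f j) = f i := by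
      intro f
      rw [Finset.sum_eq_single i]
      · simp
      · intro j _ hj; simp [Pi.single_eq_of_ne hj]
      · intro h; exact absurd (Finset.mem_univ i) h
    filter_upwards [h] with t ht
    rwa [hsingle, hsingle] at ht
  by_contra hne
  obtain ⟨m, r, q, c, hr, hmr, hqli, hqR, hcR⟩ := exists_adapted_frame Rl hne
  -- the derivation `d/dX` on `ℂ⸨X⸩`, constants `ℂ`
  obtain ⟨D, hD⟩ := exists_algDerivation_eq_derivative
  set Dv : Fin 1 → @Derivation ℂ (LaurentSeries ℂ) (LaurentSeries ℂ) _ _ _ _ _ Algebra.toModule :=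
    fun _ => D with hDv
  have hC : ∀ u : LaurentSeries ℂ, (∀ j, Dv j u = 0) →
      u ∈ Set.range (algebraMap ℂ (LaurentSeries ℂ)) := fun u hu =>
    (derivative_eq_zero_iff_mem_range_algebraMap u).1 (by rw [← hD]; exact hu 0)
  -- Taylor data
  set L : Fin n → LaurentSeries ℂ := fun i => τ (Γ i) with hL
  set E : Fin n → LaurentSeries ℂ := fun i => τ (fun t => cexp (Γ i t)) with hE
  set E' : Fin n → LaurentSeries ℂ := fun i => τ (fun t => cexp (-(Γ i t))) with hE'
  -- the reduced family for Ax
  set ℓ : Fin r → ℂ → ℂ := fun k t => ∑ i, (c k i : ℂ) * Γ i t with hℓ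
  have hℓan : ∀ k, AnalyticAt ℂ (ℓ k) 0 := fun k =>
    analyticAt_finset_sum Finset.univ (f := fun i t => (c k i : ℂ) * Γ i t)
      fun i _ => analyticAt_const.mul (hΓ i)
  set y' : Fin r → LaurentSeries ℂ := fun k => τ (ℓ k) with hy'
  set z' : Fin r → LaurentSeries ℂ := fun k => τ (fun t => cexp (ℓ k t)) with hz'
  have hzne : ∀ k, z' k ≠ 0 := fun k => ofPowerSeries_taylor_exp_ne_zero (ℓ k)
  have hexp : ∀ j k, Dv j (z' k) = z' k * Dv j (y' k) := by
    intro j k; simp only [hDv, hD]; exact derivative_taylor_exp (hℓan k)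
  -- the y' as rational combinations of the L
  have hy'L : ∀ k, y' k = ∑ i, algebraMap ℂ (LaurentSeries ℂ) (((c k i : ℚ) : ℚ) : ℂ) * L i := by
    intro k
    rw [sum_smul_τ hΓ]
    simp only [hy', hℓ, Rat.cast_intCast]
  -- integer combinations of the y' are Taylor series of rational combinations of the Γ
  have hcomb : ∀ b : Fin r → ℤ, (∑ k, (b k : LaurentSeries ℂ) * y' k) =
      ∑ i, algebraMap ℂ (LaurentSeries ℂ) (((∑ k, (b k : ℚ) * (c k i : ℚ) : ℚ) : ℂ)) * L i := by
    intro b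
    have lhs : (∑ k, (b k : LaurentSeries ℂ) * y' k) = τ (fun t => ∑ k, (b k : ℂ) * ℓ k t) := by
      rw [τ_sum Finset.univ (f := fun k t => (b k : ℂ) * ℓ k t)
        (fun k _ => analyticAt_const.mul (hℓan k))]
      refine Finset.sum_congr rfl fun k _ => ?_
      rw [τ_const_mul, map_intCast]
    rw [lhs, sum_smul_τ hΓ]
    refine τ_congr (Eventually.of_forall fun t => ?_)
    simp only [hℓ]
    push_cast
    simp only [Finset.mul_sum, Finset.sum_mul]
    rw [Finset.sum_comm]
    refine Finset.sum_congr rfl fun i _ => Finset.sum_congr rfl fun k _ => ?_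
    ring
  have hind : ∀ b : Fin r → ℤ, (∀ j, Dv j (∑ k, (b k : LaurentSeries ℂ) * y' k) = 0) → b = 0 := by
    intro b hb
    have h1 := hb 0
    simp only [hDv, hD] at h1
    rw [hcomb b, derivative_sum_eq_zero_iff hΓ] at h1
    have h2 := hcR (fun k => (b k : ℚ)) (by
      convert h1 using 1
      funext i
      simp only [Finset.sum_apply, Pi.smul_apply, smul_eq_mul])
    funext k
    have h3 := congr_fun h2 k
    simp only [Pi.zero_apply, Int.cast_eq_zero] at h3
    rw [Pi.zero_apply]
    exact h3
  -- the rank term is `≥ 1`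
  have hDy0 : D (y' ⟨0, hr⟩) ≠ 0 := by
    intro h0'
    have hmem : (fun i => (c ⟨0, hr⟩ i : ℚ)) ∈ Rl := by
      rw [← derivative_sum_eq_zero_iff hΓ, ← hy'L, ← hD]
      exact h0'
    have h2 := hcR (Pi.single ⟨0, hr⟩ 1) (by
      convert hmem using 1
      simp only [Pi.single_apply, ite_smul, one_smul, zero_smul, Finset.sum_ite_eq',
        Finset.mem_univ, if_true])
    have h3 := congr_fun h2 ⟨0, hr⟩
    simp at h3
  have hrank1 : 1 ≤ (Matrix.of fun k j => Dv j (y' k)).rank := by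
    rw [Matrix.rank]
    by_contra hlt
    push Not at hlt
    have hbot : LinearMap.range (Matrix.of fun k j => Dv j (y' k)).mulVecLin = ⊥ :=
      Submodule.finrank_eq_zero.1 (Nat.lt_one_iff.1 hlt)
    have hmem : (Matrix.of fun k j => Dv j (y' k)).mulVecLin (Pi.single 0 1) ∈
        LinearMap.range (Matrix.of fun k j => Dv j (y' k)).mulVecLin := LinearMap.mem_range_self _ _
    rw [hbot, Submodule.mem_bot, Matrix.mulVecLin_apply, Matrix.mulVec_single_one] at hmem
    have h := congrFun hmem ⟨0, hr⟩
    simp only [Matrix.col_apply, Matrix.of_apply, Pi.zero_apply, hDv] at h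
    exact hDy0 h
  -- Ax: `r + 1 ≤ trdeg_ℂ ℂ[y', z']`
  have hax := Ax1971.add_rank_le_trdeg_of_field (k := ℂ) (K := LaurentSeries ℂ) (m := 1) (n := r)
    Dv hC y' z' hzne hexp hind
  have hlow : ((r + 1 : ℕ) : Cardinal) ≤
      Algebra.trdeg ℂ (Algebra.adjoin ℂ (Set.range y' ∪ Set.range z')) := by
    refine le_trans ?_ hax
    exact_mod_cast (by omega : r + 1 ≤ r + (Matrix.of fun k j => Dv j (y' k)).rank)
  -- UPPER BOUND `trdeg_ℂ ℂ[y', z'] ≤ r - 1`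
  obtain ⟨s, hscard, halg⟩ : ∃ s : Finset (LaurentSeries ℂ), s.card + 2 ≤ r + 1 ∧
      ∀ a ∈ Algebra.adjoin ℂ (Set.range y' ∪ Set.range z'),
        IsAlgebraic (Algebra.adjoin ℂ (s : Set (LaurentSeries ℂ))) a := by
    set M := GammaField.algMatroid (LaurentSeries ℂ) with hM
    have hME : ∀ S : Set (LaurentSeries ℂ), S ⊆ M.E := fun S => by simp [hM]
    set XK : Set (LaurentSeries ℂ) := Set.range L ∪ Set.range E with hXK
    set XKp : Set (LaurentSeries ℂ) := XK ∪ Set.range E' with hXKp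
    set κ : Fin m → ℂ := fun j => ∑ i, (q j i : ℂ) * x i with hκ
    set SC : Set ℂ := Set.range κ ∪ Set.range (cexp ∘ κ) with hSC
    set KsetK : Set (LaurentSeries ℂ) := algebraMap ℂ (LaurentSeries ℂ) '' SC with hKsetK
    -- (K1) the Taylor point has rank ≤ n - 1 (specialisation of `(x, eˣ)`, `trdeg < n`)
    have hK1 : M.eRk XK ≤ ((n - 1 : ℕ) : ℕ∞) := by
      by_contra hlt
      have hn : ((n : ℕ) : ℕ∞) ≤ M.eRk XK := by
        rw [not_le] at hlt
        have h := Order.add_one_le_of_lt hlt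
        have e : ((n - 1 : ℕ) : ℕ∞) + 1 = (n : ℕ∞) := by
          have : n - 1 + 1 = n := by omega
          exact_mod_cast this
        rwa [e] at h
      obtain ⟨J, hJX, hJind, hJcard⟩ := Matroid.le_eRk_iff.1 hn
      have hrep : ∀ u ∈ XK, ∃ v : Fin n ⊕ Fin n, arcPt Γ v = u := by
        rintro u (⟨i, rfl⟩ | ⟨i, rfl⟩)
        · exact ⟨Sum.inl i, rfl⟩
        · exact ⟨Sum.inr i, rfl⟩
      choose v hv using fun u : J => hrep u (hJX u.2)
      have hJind' : AlgebraicIndependent ℚ (fun u : J => (u : LaurentSeries ℂ)) :=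
        AlgebraicIndependent.matroid_indep_iff.1 hJind
      have hfam : (fun u : J => (u : LaurentSeries ℂ)) = arcPt Γ ∘ v := by
        funext u; exact (hv u).symm
      rw [hfam] at hJind'
      have hJC : AlgebraicIndependent ℚ (Sum.elim x (cexp ∘ x) ∘ v) := by
        rw [algebraicIndependent_iff] at hJind' ⊢
        intro G hG
        apply hJind' G
        rw [← MvPolynomial.aeval_rename, ← aeval_eq_zero_iff_arc hΓ h0 hW, MvPolynomial.aeval_rename]
        exact hG
      set F₀ := IntermediateField.adjoin ℚ (range x ∪ range (cexp ∘ x)) with hF₀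
      have hmemF : ∀ w : Fin n ⊕ Fin n, Sum.elim x (cexp ∘ x) w ∈ F₀ := by
        rintro (i | i)
        · exact IntermediateField.subset_adjoin ℚ _ (Or.inl ⟨i, rfl⟩)
        · exact IntermediateField.subset_adjoin ℚ _ (Or.inr ⟨i, rfl⟩)
      let fam : J → F₀ := fun u => ⟨Sum.elim x (cexp ∘ x) (v u), hmemF (v u)⟩
      have hfam_ind : AlgebraicIndependent ℚ fam := AlgebraicIndependent.of_comp F₀.val hJC
      have hcardle := hfam_ind.cardinalMk_le_trdeg
      have hJfin : J.Finite := Set.finite_of_encard_eq_coe hJcard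
      have hJn : Cardinal.mk J = n := by
        rw [← Set.cast_ncard hJfin]
        have h1 : (J.ncard : ℕ∞) = n := by rw [hJfin.cast_ncard_eq, hJcard]
        have h2 : J.ncard = n := by exact_mod_cast h1
        rw [h2]
      rw [hJn] at hcardle
      exact (not_le.2 htr) hcardle
    -- (K3') the inverses `E'` are algebraic over `XK`
    have hXKp_cl : XKp ⊆ M.closure XK := by
      rintro u (hu | ⟨i, rfl⟩)
      · exact M.mem_closure_of_mem hu (hME _)
      · rw [hM, AlgebraicIndependent.matroid_closure_eq, SetLike.mem_coe,
          Subalgebra.mem_algebraicClosure]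
        have hEi : E i ∈ Algebra.adjoin ℚ XK := Algebra.subset_adjoin (Or.inr ⟨i, rfl⟩)
        have hinv : E' i = (E i)⁻¹ := eq_inv_of_mul_eq_one_right (τ_cexp_mul_τ_cexp_neg (hΓ i))
        rw [hinv]
        exact (isAlgebraic_algebraMap (⟨E i, hEi⟩ : Algebra.adjoin ℚ XK)).inv
    have hK1p : M.eRk XKp ≤ ((n - 1 : ℕ) : ℕ∞) :=
      calc M.eRk XKp ≤ M.eRk (M.closure XK) := M.eRk_mono hXKp_cl
        _ = M.eRk XK := M.eRk_closure_eq XK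
        _ ≤ _ := hK1
    -- (K2) the constants `κ = q·x`, `e^κ` have rank ≥ m (SchanuelRank m)
    have hK2 : (m : ℕ∞) ≤ M.eRk KsetK := by
      have hκli : LinearIndependent ℚ κ := by
        rw [Fintype.linearIndependent_iff]
        intro a ha j
        have hsum : (∑ j, a j • κ j) = ∑ i, (∑ j, a j * (q j i : ℚ)) • x i := by
          simp only [hκ, Rat.smul_def, Finset.mul_sum]
          rw [Finset.sum_comm]
          refine Finset.sum_congr rfl fun i _ => ?_
          push_cast
          rw [Finset.sum_mul]
          refine Finset.sum_congr rfl fun j _ => ?_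
          ring
        rw [hsum] at ha
        have hcoef := (Fintype.linearIndependent_iff.1 hli) _ ha
        have hvec : (∑ j, a j • fun i => (q j i : ℚ)) = 0 := by
          funext i
          simp only [Finset.sum_apply, Pi.smul_apply, smul_eq_mul, Pi.zero_apply]
          exact hcoef i
        exact (Fintype.linearIndependent_iff.1 hqli) a hvec j
      have hm : m < n := by omega
      have hSR : (m : Cardinal) ≤ Algebra.trdeg ℚ
          ↥(IntermediateField.adjoin ℚ (Set.range κ ∪ Set.range (cexp ∘ κ))) := hrank m hm κ hκli
      have h1 : (m : ℕ∞) ≤ (GammaField.algMatroid ℂ).eRk SC :=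
        ZilberHomogeneity.natCast_le_eRk_of_le_trdeg hSR
      exact h1.trans (eRk_le_eRk_image_algebraMap SC)
    -- (K3) these constants lie in `ℚ[L, E, E']`: `κ_j = Σ q L`, `e^{κ_j} = Π E^{q⁺} E'^{q⁻}`
    set S₀ : Subalgebra ℚ (LaurentSeries ℂ) := Algebra.adjoin ℚ XKp with hS₀
    have hLS : ∀ i, L i ∈ S₀ := fun i => Algebra.subset_adjoin (Or.inl (Or.inl ⟨i, rfl⟩))
    have hES : ∀ i, E i ∈ S₀ := fun i => Algebra.subset_adjoin (Or.inl (Or.inr ⟨i, rfl⟩))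
    have hE'S : ∀ i, E' i ∈ S₀ := fun i => Algebra.subset_adjoin (Or.inr ⟨i, rfl⟩)
    have hK3adj : ∀ u ∈ KsetK, u ∈ S₀ := by
      rintro u ⟨c0, hc0, rfl⟩
      rcases hc0 with ⟨j, rfl⟩ | ⟨j, rfl⟩
      · have e := sum_smul_τ_eq_algebraMap hΓ h0 (hqR j)
        have e2 : (∑ i, (((q j i : ℤ) : ℚ) : ℂ) * x i) = κ j := by
          simp only [hκ, Rat.cast_intCast]
        rw [e2] at e
        rw [← e]
        refine S₀.sum_mem fun i _ => S₀.mul_mem ?_ (hLS i)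
        rw [Rat.cast_intCast, map_intCast]
        exact S₀.intCast_mem _
      · have hev : ∀ᶠ t in 𝓝 (0:ℂ), cexp (∑ i, (q j i : ℂ) * Γ i t) = cexp (κ j) := by
          have h := eventually_eq_sum_of_mem h0 (hqR j)
          filter_upwards [h] with t ht
          simp only [Rat.cast_intCast] at ht
          rw [ht]
        have e1 : algebraMap ℂ (LaurentSeries ℂ) (cexp (κ j)) =
            τ (fun t => cexp (∑ i, (q j i : ℂ) * Γ i t)) := by
          rw [← τ_const]; exact (τ_congr hev).symm
        rw [Function.comp_apply, e1, τ_cexp_intCombination hΓ (q j)]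
        exact S₀.prod_mem fun i _ => S₀.mul_mem (S₀.pow_mem (hES i) _) (S₀.pow_mem (hE'S i) _)
    have hK3 : KsetK ⊆ M.closure XKp := by
      intro u hu
      rw [hM, AlgebraicIndependent.matroid_closure_eq, SetLike.mem_coe,
        Subalgebra.mem_algebraicClosure]
      exact isAlgebraic_algebraMap (⟨u, hK3adj u hu⟩ : S₀)
    -- bases: I₀ of the constants, extended to I of everything
    obtain ⟨I₀, hI₀⟩ := M.exists_isBasis KsetK (hME _)
    obtain ⟨I, hI, hI₀I⟩ := hI₀.indep.subset_isBasis_of_subset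
      (hI₀.subset.trans (Set.subset_union_left : KsetK ⊆ KsetK ∪ XKp)) (hME _)
    have hIcard : I.encard ≤ ((n - 1 : ℕ) : ℕ∞) := by
      rw [hI.encard_eq_eRk]
      calc M.eRk (KsetK ∪ XKp) ≤ M.eRk (M.closure XKp) :=
            M.eRk_mono (Set.union_subset hK3 (M.subset_closure XKp (hME _)))
        _ = M.eRk XKp := M.eRk_closure_eq XKp
        _ ≤ _ := hK1p
    have hI₀card : (m : ℕ∞) ≤ I₀.encard := by rw [hI₀.encard_eq_eRk]; exact hK2
    set B := I \ I₀ with hB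
    have hBI₀ : B.encard + I₀.encard = I.encard := Set.encard_sdiff_add_encard_of_subset hI₀I
    have hBfin : B.Finite := by
      refine Set.finite_of_encard_le_coe (k := n - 1) (le_trans ?_ hIcard)
      rw [← hBI₀]; exact le_self_add
    have hBcard : B.ncard + m ≤ n - 1 := by
      have h1 : (B.ncard : ℕ∞) + m ≤ ((n - 1 : ℕ) : ℕ∞) := by
        rw [hBfin.cast_ncard_eq]
        calc B.encard + m ≤ B.encard + I₀.encard := by gcongr
          _ = I.encard := hBI₀
          _ ≤ _ := hIcard
      exact_mod_cast h1
    refine ⟨hBfin.toFinset, ?_, ?_⟩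
    · rw [← Set.ncard_eq_toFinset_card B hBfin]; omega
    · set A := Algebra.adjoin ℂ ((hBfin.toFinset : Finset (LaurentSeries ℂ)) : Set (LaurentSeries ℂ))
        with hA
      have hscoe : ((hBfin.toFinset : Finset (LaurentSeries ℂ)) : Set (LaurentSeries ℂ)) = B :=
        hBfin.coe_toFinset
      -- every element of XKp is algebraic over A = ℂ[B]
      have hXalg : ∀ a ∈ XKp, IsAlgebraic A a := by
        intro a ha
        have hacl : a ∈ M.closure I := hI.subset_closure (Or.inr ha)
        rw [hM, AlgebraicIndependent.matroid_closure_eq, SetLike.mem_coe,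
          Subalgebra.mem_algebraicClosure] at hacl
        -- `ℚ[I] ⊆ A = ℂ[B]` (the elements of `I₀` are constants)
        have hsub : ∀ u ∈ Algebra.adjoin ℚ I, u ∈ A := by
          intro u hu
          induction hu using Algebra.adjoin_induction with
          | mem v hv =>
            by_cases hv0 : v ∈ I₀
            · obtain ⟨c0, -, rfl⟩ := hI₀.subset hv0
              exact A.algebraMap_mem c0
            · have hvB : v ∈ B := ⟨hv, hv0⟩
              rw [← hscoe] at hvB
              exact Algebra.subset_adjoin hvB
          | algebraMap qq =>
            rw [algebraMap_rat_eq qq]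
            exact A.algebraMap_mem _
          | add u v _ _ hu hv => exact A.add_mem hu hv
          | mul u v _ _ hu hv => exact A.mul_mem hu hv
        let ψ₀ : ↥(Algebra.adjoin ℚ I) →+* ↥A :=
          { toFun := fun u => ⟨(u : LaurentSeries ℂ), hsub u u.2⟩
            map_one' := rfl
            map_mul' := fun _ _ => rfl
            map_zero' := rfl
            map_add' := fun _ _ => rfl }
        letI : Algebra ↥(Algebra.adjoin ℚ I) ↥A := ψ₀.toAlgebra
        haveI := IsScalarTower.of_algebraMap_eq (R := ↥(Algebra.adjoin ℚ I)) (S := ↥A)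
          (A := LaurentSeries ℂ) (fun _ => rfl)
        have hψinj : Function.Injective (algebraMap ↥(Algebra.adjoin ℚ I) ↥A) := by
          intro u v huv
          apply Subtype.ext
          have := congrArg (fun w : ↥A => (w : LaurentSeries ℂ)) huv
          exact this
        exact hacl.extendScalars hψinj
      set T : Subalgebra ℂ (LaurentSeries ℂ) :=
        (Subalgebra.algebraicClosure A (LaurentSeries ℂ)).restrictScalars ℂ with hT
      have hTmem : ∀ a, IsAlgebraic A a → a ∈ T := fun a ha => ha
      have hLT : ∀ i, L i ∈ T := fun i => hTmem _ (hXalg _ (Or.inl (Or.inl ⟨i, rfl⟩)))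
      have hET : ∀ i, E i ∈ T := fun i => hTmem _ (hXalg _ (Or.inl (Or.inr ⟨i, rfl⟩)))
      have hE'T : ∀ i, E' i ∈ T := fun i => hTmem _ (hXalg _ (Or.inr ⟨i, rfl⟩))
      have hgen : Set.range y' ∪ Set.range z' ⊆ T := by
        rintro u (⟨k, rfl⟩ | ⟨k, rfl⟩)
        · rw [hy'L k]
          exact T.sum_mem fun i _ => T.mul_mem (T.algebraMap_mem _) (hLT i)
        · show τ (fun t => cexp (ℓ k t)) ∈ T
          simp only [hℓ]
          rw [τ_cexp_intCombination hΓ (c k)]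
          exact T.prod_mem fun i _ => T.mul_mem (T.pow_mem (hET i) _) (T.pow_mem (hE'T i) _)
      intro a ha
      exact Algebra.adjoin_le hgen ha
  have hup := trdeg_le_card_of_forall_isAlgebraic
    (Algebra.adjoin ℂ (Set.range y' ∪ Set.range z')) s halg
  have h1 : ((r + 1 : ℕ) : Cardinal) ≤ (s.card : Cardinal) := hlow.trans hup
  have h2 : r + 1 ≤ s.card := by exact_mod_cast h1
  omega

end Main



/-! ### Headline corollaries -/

/-- **No analytic arc of `𝒵_W` through a first failure** (the `[CharZero ℂ⸨X⸩]` instance discharged). -/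
theorem firstFailure_no_analytic_arc {n : ℕ} {x : Fin n → ℂ} (hli : LinearIndependent ℚ x)
    (htr : Algebra.trdeg ℚ ↥(IntermediateField.adjoin ℚ (range x ∪ range (cexp ∘ x))) < (n : Cardinal))
    (hrank : ∀ r < n, SchanuelRank r)
    (Γ : Fin n → ℂ → ℂ) (hΓ : ∀ i, AnalyticAt ℂ (Γ i) 0) (h0 : ∀ i, Γ i 0 = x i)
    (hW : ∀ p : MvPolynomial (Fin n ⊕ Fin n) ℚ,
      MvPolynomial.aeval (Sum.elim x (cexp ∘ x)) p = 0 →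
      ∀ᶠ t in 𝓝 (0:ℂ), MvPolynomial.aeval (Sum.elim (fun i => Γ i t) (fun i => cexp (Γ i t))) p = 0) :
    ∀ i, ∀ᶠ t in 𝓝 (0:ℂ), Γ i t = x i := by
  haveI : CharZero (LaurentSeries ℂ) :=
    charZero_of_injective_algebraMap (algebraMap ℂ (LaurentSeries ℂ)).injective
  exact no_analytic_arc_through_firstFailure hli htr hrank Γ hΓ h0 hW

/-- **… and through none of its mates with the same relations** (all mates of a first failure). -/
theorem mate_no_analytic_arc_of_symm {n : ℕ} {x x' : Fin n → ℂ}
    (hrank : ∀ r < n, SchanuelRank r) (hx'li : LinearIndependent ℚ x')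
    (htr' : Algebra.trdeg ℚ ↥(IntermediateField.adjoin ℚ (range x' ∪ range (cexp ∘ x'))) < (n : Cardinal))
    (hsymm : ∀ p : MvPolynomial (Fin n ⊕ Fin n) ℚ,
      MvPolynomial.aeval (Sum.elim x' (cexp ∘ x')) p = 0 →
      MvPolynomial.aeval (Sum.elim x (cexp ∘ x)) p = 0)
    (Γ : Fin n → ℂ → ℂ) (hΓ : ∀ i, AnalyticAt ℂ (Γ i) 0) (h0 : ∀ i, Γ i 0 = x' i)
    (hW : ∀ p : MvPolynomial (Fin n ⊕ Fin n) ℚ,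
      MvPolynomial.aeval (Sum.elim x (cexp ∘ x)) p = 0 →
      ∀ᶠ t in 𝓝 (0:ℂ), MvPolynomial.aeval (Sum.elim (fun i => Γ i t) (fun i => cexp (Γ i t))) p = 0) :
    ∀ i, ∀ᶠ t in 𝓝 (0:ℂ), Γ i t = x' i := by
  exact firstFailure_no_analytic_arc hx'li htr' hrank Γ hΓ h0 fun p hp => hW p (hsymm p hp)

/-- Contrapositive packaging: a first failure admits no NON-CONSTANT analytic arc inside `𝒵_W`. -/
theorem not_exists_nonconstant_arc {n : ℕ} {x : Fin n → ℂ} (hli : LinearIndependent ℚ x)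
    (htr : Algebra.trdeg ℚ ↥(IntermediateField.adjoin ℚ (range x ∪ range (cexp ∘ x))) < (n : Cardinal))
    (hrank : ∀ r < n, SchanuelRank r) :
    ¬ ∃ (Γ : Fin n → ℂ → ℂ), (∀ i, AnalyticAt ℂ (Γ i) 0) ∧ (∀ i, Γ i 0 = x i) ∧
      (∀ p : MvPolynomial (Fin n ⊕ Fin n) ℚ,
        MvPolynomial.aeval (Sum.elim x (cexp ∘ x)) p = 0 →
        ∀ᶠ t in 𝓝 (0:ℂ), MvPolynomial.aeval (Sum.elim (fun i => Γ i t) (fun i => cexp (Γ i t))) p = 0) ∧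
      ∃ i, ¬ ∀ᶠ t in 𝓝 (0:ℂ), Γ i t = x i := by
  rintro ⟨Γ, hΓ, h0, hW, i, hi⟩
  exact hi (firstFailure_no_analytic_arc hli htr hrank Γ hΓ h0 hW i)

/-- The simplest instance: the STRAIGHT LINE through a first failure in a rational direction `v ≠ 0`
(`Γᵢ(t) = xᵢ + vᵢ t`) is not inside `𝒵_W` — some ℚ-relation of `(x, eˣ)` fails along it near `0`. -/
theorem line_not_in_locus {n : ℕ} {x : Fin n → ℂ} (hli : LinearIndependent ℚ x)
    (htr : Algebra.trdeg ℚ ↥(IntermediateField.adjoin ℚ (range x ∪ range (cexp ∘ x))) < (n : Cardinal))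
    (hrank : ∀ r < n, SchanuelRank r) (v : Fin n → ℚ) (hv : v ≠ 0) :
    ¬ ∀ p : MvPolynomial (Fin n ⊕ Fin n) ℚ,
        MvPolynomial.aeval (Sum.elim x (cexp ∘ x)) p = 0 →
        ∀ᶠ t in 𝓝 (0:ℂ), MvPolynomial.aeval
          (Sum.elim (fun i => x i + (v i : ℂ) * t) (fun i => cexp (x i + (v i : ℂ) * t))) p = 0 := by
  intro hW
  obtain ⟨i, hi⟩ : ∃ i, v i ≠ 0 := by
    by_contra h
    push Not at h
    exact hv (funext h)
  have h := firstFailure_no_analytic_arc hli htr hrank (fun i t => x i + (v i : ℂ) * t)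
    (fun i => analyticAt_const.add (analyticAt_const.mul analyticAt_id)) (fun i => by simp) hW i
  have h' : ∀ᶠ t in 𝓝 (0:ℂ), (v i : ℂ) * t = 0 := by
    filter_upwards [h] with t ht
    have := ht
    rw [add_eq_left] at this
    exact this
  obtain ⟨ε, hε, hball⟩ := Metric.eventually_nhds_iff.1 h'
  have hε2 : dist ((ε / 2 : ℝ) : ℂ) 0 < ε := by
    rw [dist_zero_right, Complex.norm_real, Real.norm_eq_abs, abs_of_pos (half_pos hε)]
    exact half_lt_self hε
  have := hball hε2
  rcases mul_eq_zero.1 this with h1 | h1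
  · exact hi (by exact_mod_cast h1)
  · have : (ε / 2 : ℝ) = 0 := by exact_mod_cast h1
    linarith

end Summit.Schanuel.Schanuel.Cruxes.MinimalCounterexampleInAcl.DisproofNoArc

end
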